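import Summits.Ventures.Crystal3D.Theorems.StickyWulffConstantNoReconstructionGainExactCriminalSmall
import HarnessLib

/-!
# EXACT₀ holds for lattice films: no criminal is made of sites (line `replication-exactness`, rung R3)

HONEST FRAMING. Part of the venture `Summits/Ventures/Crystal3D` (cell `crystal3d-full`), supports the
crux `NoReconstructionGain` (stmt-Ventures-19144, route `route-Ventures-StickyWulffConstant`), line
`replication-exactness` (lead wulff-p1 g17).  The first EXACT₀ INSTANCE theorem in the exact currency:

* `exactZeroGain_of_subset_fcc` — a film on a rigid half-crystal face all of whose balls are SITES of
  `Λ₀` has exact zero gain, `X(H,Q) ≤ D(Q)`, for every unit `ν` and every cut `s` (no radius, no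
  constant).  Proof: the plug sites of `Q` lie in the finite CONVEX lattice sample
  `P'' = Λ₀ ∩ {⟪p,ν⟫ ≤ s} ∩ B(0, ϱ)` for `ϱ` large; `Q` is a lattice film on it, and the landed
  convex-sample lattice no-gain (`cross_le_contactDeficiency_of_convex_sample`, …LatticeAdhesion) bounds
  the cross count, which dominates the plug count;
* `exists_not_mem_fcc_of_criminal` — hence **every criminal contains an off-lattice ball**;
* `five_le_card_of_criminal` — and therefore **every criminal has at least five balls** (an off-lattice
  ball has `≤ 3` plugs and `plug + deg ≥ 7`).

WHAT THIS IS NOT: EXACT₀ for films with off-lattice balls is the crux proper; rung F-C1 not moved.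
-/

noncomputable section

namespace Summit.Ventures.Crystal3D.Theorems

open Summit.Ventures.Crystal3D
open Literature.MathematicalPhysics.StatisticalMechanics (fccStacking isHaggSeq_const
  le_dist_of_mem_barlowStacking_ideal contactDeficiency orderedContacts UniformlyDiscrete)
open scoped InnerProductSpace
open Finset

/-- **EXACT₀ for lattice films.**  A film on `H(ν,s)` consisting of lattice sites has `X(H,Q) ≤ D(Q)`. -/
theorem exactZeroGain_of_subset_fcc {ν : EuclideanSpace ℝ (Fin 3)} {s : ℝ}
    {Q : Finset (EuclideanSpace ℝ (Fin 3))} (hQ : IsFilmOn ν s Q)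
    (hQΛ : ∀ q ∈ Q, q ∈ fccStacking 1 (Real.sqrt (2 / 3))) :
    (plugCount ν s Q : ℝ) ≤ contactDeficiency Q := by
  classical
  -- a ball around the origin containing every plug site
  set ϱ : ℝ := (∑ q ∈ Q, ‖q‖) + 1 with hϱ
  have hϱ0 : 0 ≤ ϱ := by
    have : 0 ≤ ∑ q ∈ Q, ‖q‖ := Finset.sum_nonneg fun q _ => norm_nonneg q
    linarith
  have hqϱ : ∀ q ∈ Q, ‖q‖ + 1 ≤ ϱ := fun q hq => by
    have := Finset.single_le_sum (f := fun q => ‖q‖) (fun q _ => norm_nonneg q) hq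
    rw [hϱ]; linarith
  -- the convex lattice sample below the cut inside that ball
  set K : Set (EuclideanSpace ℝ (Fin 3)) := {p | ⟪p, ν⟫_ℝ ≤ s ∧ ‖p‖ ≤ ϱ} with hK
  have hKconv : Convex ℝ K := by
    have h1 : Convex ℝ {p : EuclideanSpace ℝ (Fin 3) | ⟪p, ν⟫_ℝ ≤ s} := by
      have : {p : EuclideanSpace ℝ (Fin 3) | ⟪p, ν⟫_ℝ ≤ s} = {p | (innerSL ℝ ν) p ≤ s} := by
        ext p; simp [real_inner_comm]
      rw [this]; exact convex_halfSpace_le (innerSL ℝ ν).isLinear s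
    have h2 : Convex ℝ {p : EuclideanSpace ℝ (Fin 3) | ‖p‖ ≤ ϱ} := by
      have : {p : EuclideanSpace ℝ (Fin 3) | ‖p‖ ≤ ϱ} = Metric.closedBall 0 ϱ := by
        ext p; simp
      rw [this]; exact convex_closedBall 0 ϱ
    have := h1.inter h2
    convert this using 1
    rw [hK]; ext p; simp only [Set.mem_setOf_eq, Set.mem_inter_iff]
  have hfin := fcc_uniformlyDiscrete.finite_inter_closedBall 0 ϱ
  set P'' : Finset (EuclideanSpace ℝ (Fin 3)) := hfin.toFinset.filter fun p => ⟪p, ν⟫_ℝ ≤ s with hP''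
  have hmemP'' : ∀ p, p ∈ P'' ↔ (p ∈ fccStacking 1 (Real.sqrt (2 / 3)) ∧ p ∈ K) := by
    intro p
    rw [hP'', Finset.mem_filter, Set.Finite.mem_toFinset, Set.mem_inter_iff, Metric.mem_closedBall,
      dist_zero_right, hK, Set.mem_setOf_eq]
    tauto
  -- `Q` is a lattice film on it
  have hdisj : Disjoint P'' Q := by
    rw [Finset.disjoint_left]
    intro p hp hpQ
    obtain ⟨hpΛ, hps, -⟩ := (hmemP'' p).1 hp
    have := hQ.2 p hpQ p ⟨hpΛ, hps⟩
    rw [dist_self] at this; linarith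
  set X := P'' ∪ Q with hX
  have hXΛ : (↑X : Set (EuclideanSpace ℝ (Fin 3))) ⊆ fccStacking 1 (Real.sqrt (2 / 3)) := by
    intro p hp
    rw [Finset.mem_coe, hX, Finset.mem_union] at hp
    rcases hp with hp | hp
    · exact ((hmemP'' p).1 hp).1
    · exact hQΛ p hp
  have hcross := cross_le_contactDeficiency_of_convex_sample X P'' K hKconv hXΛ Finset.subset_union_left hmemP''
  rw [show X \ P'' = Q by rw [hX, Finset.union_sdiff_cancel_left hdisj]] at hcross
  -- every plug is a cross contact from `P''`
  refine le_trans ?_ hcross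
  rw [card_cross_eq_sum, plugCount]; push_cast
  refine Finset.sum_le_sum fun q hq => ?_
  exact_mod_cast plugSet_ncard_le_card_filter ν s P'' q fun z hz => by
    obtain ⟨⟨hzΛ, hzs⟩, hzd⟩ := hz
    refine (hmemP'' z).2 ⟨hzΛ, hzs, ?_⟩
    calc ‖z‖ ≤ ‖q‖ + dist z q := by
          have := norm_sub_norm_le z q; rw [← dist_eq_norm] at this; linarith
      _ = ‖q‖ + 1 := by rw [dist_comm, hzd]
      _ ≤ ϱ := hqϱ q hq

/-- **Every criminal contains an off-lattice ball.** -/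
theorem exists_not_mem_fcc_of_criminal {ν : EuclideanSpace ℝ (Fin 3)} {s : ℝ}
    {Q : Finset (EuclideanSpace ℝ (Fin 3))} (hQ : IsCriminal ν s Q) :
    ∃ q ∈ Q, q ∉ fccStacking 1 (Real.sqrt (2 / 3)) := by
  classical
  by_contra h
  push Not at h
  obtain ⟨hfilm, hne, hcore⟩ := hQ
  have h1 := hcore Q (Finset.Subset.refl Q) hne
  have h2 := exactZeroGain_of_subset_fcc hfilm h
  simp only [Finset.sdiff_self, Finset.empty_product, Finset.filter_empty, Finset.card_empty,
    Nat.cast_zero, add_zero] at h1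
  linarith

/-- **Every criminal has at least five balls**: it contains an off-lattice ball (`≤ 3` plugs), which is
strictly over-attached (`plug + deg ≥ 7`), hence has `≥ 4` partners inside the film. -/
theorem five_le_card_of_criminal {ν : EuclideanSpace ℝ (Fin 3)} {s : ℝ}
    {Q : Finset (EuclideanSpace ℝ (Fin 3))} (hQ : IsCriminal ν s Q) : 5 ≤ Q.card := by
  classical
  obtain ⟨q, hq, hqΛ⟩ := exists_not_mem_fcc_of_criminal hQ
  have h7 := seven_le_plug_add_deg_of_criminal hQ hq
  have h3 := plugSet_ncard_le_three_of_not_mem (ν := ν) (s := s) hqΛ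
  have hdeg : (Q.filter fun y => dist q y = 1).card ≤ (Q.erase q).card := by
    refine Finset.card_le_card fun y hy => ?_
    rw [Finset.mem_filter] at hy
    rw [Finset.mem_erase]
    refine ⟨?_, hy.1⟩
    rintro rfl
    rw [dist_self] at hy; norm_num at hy
  rw [Finset.card_erase_of_mem hq] at hdeg
  omega

end Summit.Ventures.Crystal3D.Theorems

end
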